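import Literature.Algebra.Homology.TorsionLifting
import Mathlib.LinearAlgebra.TensorProduct.Quotient
import Mathlib.LinearAlgebra.TensorProduct.RightExactness
import Mathlib.RingTheory.Ideal.Quotient.Operations
import Mathlib.RingTheory.TensorProduct.Basic
import HarnessLib

/-!
# Lifting cocycles from a thickening `A = Λ/π^{e+1}` to genuine cocycles, modulo `π`

The base-changed form of the lifting lemma of `Literature/Algebra/Homology/TorsionLifting`, in the
shape produced by the Čech comparison `H⁰(X ×_Λ Spec A, 𝓛) ≅ Ker(d⁰ ⊗_Λ A)` of
`Motives/GrothendieckComplexSectionAlongCech`: for a complex `C⁰ →ᵈ C¹ →ᵈ' C²` of `Λ`-modules with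
`π` a non-zero-divisor on `C²` and `e` a bound for the `π`-power torsion of `H¹`, a `Λ`-algebra `A`
onto which `Λ` surjects with kernel `(π^{e+1})` (`A ≅ Λ/π^{e+1}`), and a `Λ`-algebra map `v : A → A₀`
into an algebra killing `π` (`A₀ = Λ/π`, the closed point), **every cocycle `z ∈ Ker(d ⊗ A)` has
a genuine cocycle `c ∈ Ker d` with the same image in `A₀ ⊗ C⁰`** (`exists_mem_ker_rTensor_eq`):
`z = 1 ⊗ y` (`Λ → A` is onto), `d y ∈ π^{e+1} C¹` (`A ⊗ C¹ = C¹/π^{e+1}C¹`, Mathlib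
`TensorProduct.quotTensorEquivQuotSMul`), so `y` lifts to a cocycle `c ≡ y (mod π)` by
`exists_mem_ker_sub_eq_smul`, and `1 ⊗ (c - y) = 0` in `A₀ ⊗ C⁰`.

This is the step "`H⁰(X, 𝓛) → H⁰(X₀, 𝓛₀)` hits the image of `H⁰(X_e, 𝓛_e)`" of the theorem on formal
functions (EGA III₁ 4.1.5 / Hartshorne III Thm. 11.1) in elementary form. Fully proved; no named facts.

## References

* R. Hartshorne, *Algebraic Geometry*, GTM 52 (1977): III Thm. 11.1 (proof). [Hartshorne1977]
* The Stacks Project, Tag 02OC. [StacksProject]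
-/

universe u v

namespace Literature.Algebra.Homology

open LinearMap TensorProduct

variable {Λ : Type u} [CommRing Λ]

/-- The inverse `A → Λ/I` of the first isomorphism theorem for `Λ → A` surjective with kernel `I`,
as a `Λ`-linear map. [folklore] -/
noncomputable def quotInv {A : Type u} [CommRing A] [Algebra Λ A]
    (hA : Function.Surjective (algebraMap Λ A)) :
    A →ₗ[Λ] Λ ⧸ RingHom.ker (algebraMap Λ A) where
  toFun := (RingHom.quotientKerEquivOfSurjective hA).symm
  map_add' x y := map_add _ x y
  map_smul' r a := by
    obtain ⟨b, rfl⟩ := hA a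
    rw [RingHom.id_apply, Algebra.smul_def, ← map_mul,
      RingHom.quotientKerEquivOfSurjective_symm_apply, RingHom.quotientKerEquivOfSurjective_symm_apply,
      Algebra.smul_def, Ideal.Quotient.algebraMap_eq, map_mul]

/-- `quotInv 1 = 1`. [folklore] -/
theorem quotInv_one {A : Type u} [CommRing A] [Algebra Λ A]
    (hA : Function.Surjective (algebraMap Λ A)) : quotInv hA 1 = 1 := by
  change (RingHom.quotientKerEquivOfSurjective hA).symm 1 = 1
  exact map_one _

/-- **`1 ⊗ m = 0` in `A ⊗_Λ M` implies `m ∈ I M`, for `Λ → A` surjective with kernel `I`** (through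
the first isomorphism theorem and `(Λ/I) ⊗ M ≅ M/IM`). [folklore] -/
theorem mem_smul_top_of_one_tmul_eq_zero {A : Type u} [CommRing A] [Algebra Λ A]
    (hA : Function.Surjective (algebraMap Λ A)) {M : Type v} [AddCommGroup M] [Module Λ M]
    {m : M} (hm : (1 : A) ⊗ₜ[Λ] m = 0) :
    m ∈ (RingHom.ker (algebraMap Λ A) • (⊤ : Submodule Λ M)) := by
  have h1 := congrArg ((quotInv hA).rTensor M) hm
  rw [LinearMap.rTensor_tmul, map_zero, quotInv_one] at h1
  have h2 := congrArg (quotTensorEquivQuotSMul M (RingHom.ker (algebraMap Λ A))) h1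
  rw [quotTensorEquivQuotSMul_mk_one_tmul, map_zero] at h2
  exact (Submodule.Quotient.mk_eq_zero _).1 h2

/-- `m ∈ (π^k) • M` means `m = π^k m'`. [folklore] -/
theorem exists_eq_pow_smul_of_mem_span_smul {M : Type v} [AddCommGroup M] [Module Λ M] {π : Λ}
    {k : ℕ} {m : M} (hm : m ∈ (Ideal.span {π ^ k} • (⊤ : Submodule Λ M))) :
    ∃ m' : M, m = π ^ k • m' := by
  rw [Submodule.ideal_span_singleton_smul] at hm
  obtain ⟨m', -, rfl⟩ := (Submodule.mem_smul_pointwise_iff_exists _ _ _).1 hm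
  exact ⟨m', rfl⟩

section Lift

variable {C₀ : Type v} {C₁ : Type v} {C₂ : Type v} [AddCommGroup C₀] [Module Λ C₀]
  [AddCommGroup C₁] [Module Λ C₁] [AddCommGroup C₂] [Module Λ C₂]
  (d : C₀ →ₗ[Λ] C₁) (d' : C₁ →ₗ[Λ] C₂)

/-- **Cocycles over the thickening `A ≅ Λ/π^{e+1}` come from genuine cocycles, modulo `π`.**
Let `C⁰ →ᵈ C¹ →ᵈ' C²` be `Λ`-linear with `d' ∘ d = 0`, `π` a non-zero-divisor on `C²`, `e` a bound
for the `π`-power torsion of `Ker d'/Im d`; let `A` be a `Λ`-algebra with `Λ → A` surjective of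
kernel `(π^{e+1})`, and `v : A → A₀` a `Λ`-algebra map with `π A₀ = 0`. Then for every
`z ∈ A ⊗ C⁰` with `(d ⊗ A) z = 0` there is `c ∈ Ker d` with `(v ⊗ 1) z = 1 ⊗ c` in `A₀ ⊗ C⁰`.
[cite: Hartshorne1977, III Thm. 11.1 (proof)] -/
theorem exists_mem_ker_rTensor_eq (hdd : ∀ x, d' (d x) = 0) (π : Λ)
    (hπ₂ : ∀ y : C₂, π • y = 0 → y = 0) (e : ℕ)
    (htor : ∀ y : C₁, d' y = 0 → (∃ k : ℕ, π ^ k • y ∈ range d) → π ^ e • y ∈ range d)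
    {A : Type u} [CommRing A] [Algebra Λ A] (hA : Function.Surjective (algebraMap Λ A))
    (hkerA : RingHom.ker (algebraMap Λ A) = Ideal.span {π ^ (e + 1)})
    {A₀ : Type u} [CommRing A₀] [Algebra Λ A₀] (v : A →ₐ[Λ] A₀) (hA₀ : algebraMap Λ A₀ π = 0)
    {z : A ⊗[Λ] C₀} (hz : d.baseChange A z = 0) :
    ∃ c : C₀, d c = 0 ∧ v.toLinearMap.rTensor C₀ z = (1 : A₀) ⊗ₜ[Λ] c := by
  -- `z = 1 ⊗ y`
  have hone : ∀ x : Λ ⊗[Λ] C₀, ∃ y : C₀, (Algebra.linearMap Λ A).rTensor C₀ x = (1 : A) ⊗ₜ[Λ] y := by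
    intro x
    induction x using TensorProduct.induction_on with
    | zero => exact ⟨0, by simp⟩
    | tmul a c => exact ⟨a • c, by simp [Algebra.linearMap_apply, Algebra.algebraMap_eq_smul_one, smul_tmul]⟩
    | add x x' hx hx' =>
      obtain ⟨y, hy⟩ := hx
      obtain ⟨y', hy'⟩ := hx'
      exact ⟨y + y', by rw [map_add, hy, hy', tmul_add]⟩
  obtain ⟨yt, rfl⟩ := LinearMap.rTensor_surjective C₀ (g := Algebra.linearMap Λ A) hA z
  obtain ⟨y, hy⟩ := hone yt
  rw [hy] at hz ⊢
  -- `d y ∈ π^{e+1} C¹`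
  rw [LinearMap.baseChange_tmul] at hz
  have hdy : d y ∈ (Ideal.span {π ^ (e + 1)} • (⊤ : Submodule Λ C₁)) := by
    rw [← hkerA]; exact mem_smul_top_of_one_tmul_eq_zero hA hz
  obtain ⟨w, hw⟩ := exists_eq_pow_smul_of_mem_span_smul hdy
  -- lift
  obtain ⟨c, hc, w', hcw⟩ := exists_mem_ker_sub_eq_smul d d' hdd π hπ₂ e htor (n := e) (Nat.le_succ e) hw
  refine ⟨c, hc, ?_⟩
  rw [LinearMap.rTensor_tmul, AlgHom.toLinearMap_apply, map_one]
  have e1 : c = y + π ^ (e + 1 - e) • w' := by rw [← hcw]; abel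
  rw [e1, tmul_add, show e + 1 - e = 1 by omega, pow_one, tmul_smul, smul_tmul',
    Algebra.smul_def, hA₀, zero_mul, zero_tmul, add_zero]

end Lift

end Literature.Algebra.Homology
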